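import Summits.HodgeConjecture.HodgeConjecture.Theorems.Ring2AbelianAllSpreadQbar
import HarnessLib

/-!
# Ring 2 · §AbelianAll · SPREAD, part IX — the ARITHMETIC-EFFECTIVE face of the `ℚ̄`-road: spreading
# algebraicity from the closed points of `Spec 𝒪_k` under a COMPLEXITY BOUND, and the residual `N_E`

research route, not a corollary; conditional on HC_CM plus one named minimal statement.
Research route conditional on HC_CM; not a corollary; Q11.4-sentence-2 already refuted in dim ≥ 3.

Bindings as in parts VI–VIII: `HC_CM` = `Theses.RankFourFaces.CMAbelianHodge` (OPEN item stmt-3052; a BINDER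
wherever it occurs, never a fact), `HC_AV` = `Theses.PadicSemiregularLift.HodgeAbelianVarieties` (stmt-1333),
`HC_QbarAV` = `Ring2.Deform.HodgeConjectureQbarAV` (OPEN). The item `CMToAbelian` (stmt-HodgeConjecture-16267) stays
OPEN and is not re-filed. Nothing minted here is a Literature record or is cited anywhere as a fact; "minimal" is not
claimed (F-ab-4); the fact-free `B_min` of record stays part VII's `F_CM` (LEAD L15.3 (ix)).

WHY THIS PART. Part V (request M1) showed on the COMPLEX axis that uniform algebraicity at CM points equals its
degree-EFFECTIVE and GERM forms (`U ⟺ U_eff ⟺ U_germ`). The ARITHMETIC axis (deform's `Ring2DeformArithmeticLifting`: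
base `Spec 𝒪_k`, dense set = the closed points, nodes `L`, `L₁`, `R₁`, rows A/A′, no-go D.18) had no effective face.
Typing it SPLITS deform's rational lifting into
* a print-level half `E` = `EffectiveArithmeticSpreading 𝔇 κ`: a Hodge class on `A/ℚ̄` whose specialisations at
  INFINITELY MANY primes are classes of rational algebraic cycles of BOUNDED COMPLEXITY (`κ ≤ d`, one `ℓ`) is
  algebraic — TRUE IN PRINT for the intended carriers (sketch below), typed as a SUPPLY NODE (a hypothesis wherever
  used, never asserted, not vendored: no verbatim locator exists, HONEST COLUMN (d)); and
* an OPEN growth statement `N_E` = `NoComplexityEscape 𝔇 κ`: if the specialisations of a Hodge class are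
  rationally algebraic at almost all primes (deform's junction target `J′`, which `HC_CM` supplies through
  Kisin–Milne CM lifting, binder `hJ'`), then their complexity stays bounded along infinitely many primes.
So the open content of the arithmetic road is a DIOPHANTINE statement on the growth of `p ↦ κ(γ₀(p))`, not an
algebraicity statement: `HC_QbarAV ⟺ HC_CM ∧ N_E` modulo the print binders `[hJ', E, Z, hQC]`
(`HC_QbarAV_iff_HC_CM_and_noComplexityEscape`), and with part VIII's fact-free `F_ℚ̄`,
`HC_AV ⟺ HC_CM ∧ N_E ∧ F_ℚ̄` (`HC_AV_iff_HC_CM_and_noComplexityEscape_and_hodgeFailureSpreadsToQbarFibre`).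

PROOF SKETCH OF `E` — PRINT-LEVEL, ASSEMBLED: no single verbatim locator exists, so `E` stays a bare SUPPLY
hypothesis without `[cite:]`; REFEREED at the seat's request `R-IX-E` (deform seat, 2026-08-20, RING2-MAP D.85):
verdict print-level YES, with the boundedness step (iv) re-worded as below (rev. 2 of this docstring; no statement of
this file changed). Intended `𝔇` = `ℓ`-adic cohomology with Artin comparison and smooth-proper cospecialisation
[Milne2009RationalTate, §3.1]; intended `κ` = `θ`-degree complexity. (i) DESCENT: Hodge classes on abelian
varieties are absolute Hodge [Deligne1982HodgeCycles, Thm. 2.11] and `Gal` acts on `C_AH` through a finite quotient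
[ibid., Prop. 2.9(b)], so `A`, a polarisation `θ` and the class descend to a number field `k` with `t_ℓ`
Galois-fixed — verbatim the first half of the proof of [ibid., Cor. 6.2]. (ii) MODEL: `A` extends to a polarised
abelian scheme `f : 𝒜 → U` over a dense open `U ⊂ Spec 𝒪_k[1/ℓ]` [Milne1986AbelianVarieties, Rem. 20.9]; an
abelian scheme over a discrete valuation ring is the Néron model of its generic fibre [Artin1986NeronModels,
Cor. 1.4], so at a place `𝔭 ∈ U` above `p` the special fibre of deform's model is `A₀ = 𝒜 ⊗ 𝔽̄_p` and
`γ₀(p) = t_ℓ(𝔭̄)`. (iii) `t_ℓ ∈ H⁰(U, R^{2r}f_*ℚ_ℓ(r))`, a LISSE sheaf (unramified action on `U`). (iv) BOUNDEDNESS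
OVER `U`: integral subschemes of the geometric fibres of `𝒜/U` of dimension `g − r` and `θ`-degree `≤ d` are
points of `Chow°_{g−r,≤d}(𝒜/U)`, which is OF FINITE TYPE OVER `U` — stated over an arbitrary base `S` for `Y/S`
projective with a relatively very ample `𝒪_Y(1)` [Kollar2023, (3.7.1), 4.70] (= [Kollar1996, Ch. I §3–4]); the
flattening stratification of the universal family has finitely many non-empty strata [GortzWedhorn2023,
Thm. 23.159], giving `T = ⊔ T_Φ` of finite type over `U` with a `T`-flat family `𝒵 → T` (`T_Φ → Hilb_Φ(𝒜/U)`,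
projective over `U` [Kollar2023, (3.7.2)]); tuples `(N, nᵢ)` with `|N| + Σ|nᵢ|·deg_θ Zᵢ ≤ d` have finitely many
shapes. (v) `κ` is evaluated only on the integral INPUT cycles (points of `Chow°`); the output over the generic
point is a fibre of a FLAT family, used only through its fundamental cycle [Kollar2023, (4.61.1)] and its class.
(vi) The relative class of a `T`-flat closed `𝒵 ⊂ 𝒜_T` is a section of the lisse sheaf `R^{2r}π_*ℚ_ℓ(r)` on `T`,
compatible with base change [DeligneSGA4half1977, Cycle §2.3], so the locus `G ⊂ T` where `N·t_ℓ = Σ nᵢ cl(𝒵ᵢ)` is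
open and closed (two sections of a lisse sheaf on a connected noetherian scheme agreeing at one geometric point
agree). (vii) Its image in `U` is constructible [StacksProject, Tag 054K] and contains infinitely many closed points
of the one-dimensional irreducible `U`, hence the generic point `η`. (viii) A CLOSED point of `G_η` (residue field
finite over `k`) carries cycles over `ℚ̄` with `N·t_ℓ = Σ nᵢ cl(Zᵢ)` in `H^{2r}_ℓ(A_ℚ̄)`. (ix) Artin comparison,
compatibility of cycle classes and `H_B(ℚ) ↪ H_B ⊗ ℚ_ℓ` give the relation in `H^{2r}(A_ℂ, ℚ)`, and `t` is algebraic
[Fulton1998, §19.2] [Andre1996Motifs, §9.4]. LEFSCHETZ ESCAPE: the same (i)–(ix) run with products of divisors show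
that a NON-Lefschetz Hodge class has reductions of UNBOUNDED Lefschetz-complexity along the supersingular primes,
where every class IS Lefschetz (`LenstraZarhin1993_supersingular_lefschetzClasses_eq_top`): bounded complexity is
not free at supersingular primes, which is why `E` — unlike deform's single-prime span node `L₁` (no-go D.18) —
does not visibly swallow `HC_CM`.

WHAT IS TYPED. §A DATA: `ComplexityGauge 𝔇` (an `ℕ∞`-valued gauge on each `H^{2r}_ℓ(A₀)`, finite exactly on
`ratAlgebraicClasses`; an explicit binder `κ`, never quantified inside a node; `ComplexityGauge.trivial` shows the
type inhabited and is the degenerate reading under which `E` says "rational lifting at infinitely many primes").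
§B hypothesis shapes. §C nodes (`@[conjecture]`; OPEN or SUPPLY; hypotheses wherever used): `N_E`;
`R_aa` = `RationalLiftingAtAlmostAllPrimesAV` (the rational twin of deform's `L`, untyped there); `B_all` =
`BoundedReductionsAV` (a REFORMULATION of the endpoint: `HC_QbarAV ⟺ B_all` mod `[E, Z]`); the supply nodes `E` and
`Z` = `CycleReductionsBounded` (algebraic classes have cofinitely bounded reductions). §D kernel rows, `[folklore]`
logic on binders: on path `HC_QbarAV ⟹ N_E, R_aa, B_all`; lattice `R₁ ⟹[hgood] R_aa ⟺[E,Z] N_E`; rows IX-A/B;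
audit from the summit.

HONEST COLUMN. (a) KIND of `N_E` relative to `HC_CM`: 2 (complementary), and ROBUSTLY so — to use `N_E` on a CM
abelian variety one needs its hypothesis, the `J′`-matrix at almost all primes, which is Tate-conjecture content at
ordinary primes and Milne-rationality content at supersingular ones; unlike deform's `R₁` it does not turn
dominating the day Conjecture B of [Milne2025AbelianMotivesCharP, §4] (unrefereed) is known for CM abelian
varieties. (b) `E`, `Z`, `hJ'`, `hgood`, `hQC` are print chains kept as binders; a degenerate `𝔇` or `κ` changes
what the nodes say — a row's content is the pair (junctions for the INTENDED carriers, node), exactly as in deform.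
(c) LEAD may count row IX-A once with deform's row A′ (D.17); new are the factorisation `R_aa ⟺ N_E` mod `[E, Z]`
with `E` print-level, the growth form of the residual, `R_aa` typed, and the Lefschetz-escape remark. (d) PRESEARCH
for `E` / `N_E` verbatim: none (corpus fts + hybrid + vec: "specialisation algebraic cycles bounded degree Chow number
field reduction Hodge", "bounded degree reductions infinitely many primes lifts characteristic zero"; galaxy pdf/all
substring "lifts to characteristic zero|infinitely many primes|bounded degree"); nearest print: injectivity of
specialisation on Néron–Severi groups (Pannekoek–Top–van Luijk 2015 p. 4, after van Luijk 2007 Prop. 6.2 and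
Maulik–Poonen 2012 Prop. 3.6; divisors, no bound needed) and the `p`-adic variational Hodge conjecture
[BlochEsnaultKerz2014pAdic, Conj. 2] (one prime, no bound). RING2-MAP `## §AbelianAll (ab-spread-1, gen 10)`,
gen 12 (rev. 2). (e) CONSISTENCY of the `J` (span) / `J′` (rational) split at the smallest carrier (request
`C-IX-JJ′`, answered by the deform seat, RING2-MAP D.84; folklore, Deuring + Skolem–Noether): on `E × E` with `E` CM
by `𝒪_K`, at an inert prime `p` the rational `(2,0)+(0,2)` plane `Kσ ⊂ End(H¹_B(E)) = M₂(ℚ)` specialises into the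
`ℚ_ℓ`-SPAN of divisor classes (`ρ(E_p²) = 6 = b₂`) yet meets the algebraic `ℚ`-form `Kj ⊂ B_{p,∞}` of the same
`ℚ_ℓ`-plane only in `0` (squares of opposite sign) — span-algebraic, not rationally algebraic; `κ` and `N_E` live on
the `J′` side, as typed.
-/

-- The cell namespace repeats the summit's name (D-0017 nested layout); the duplication is the tree convention.
set_option linter.dupNamespace false

noncomputable section

namespace Summit.HodgeConjecture.HodgeConjecture.Ring2.AbelianAll

open CategoryTheory AlgebraicGeometry
open scoped TensorProduct
open Literature.AlgebraicTopology.SingularHomology Literature.AlgebraicGeometry Literature.AlgebraicGeometry.Motives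
open Literature.AlgebraicGeometry.HodgeTheory
open Summit.HodgeConjecture.HodgeConjecture.Theses.RankFourFaces (CMAbelianHodge)
open Summit.HodgeConjecture.HodgeConjecture.Theses.PadicSemiregularLift (HodgeAbelianVarieties)
open Summit.HodgeConjecture.HodgeConjecture.Ring2.Deform (RealizationFamily specialisedClass HodgeConjectureQbarAV
  SpecialisationsRationalAV RationalLiftingAtOnePrimeAV hodgeConjectureQbarAV_of_HC_AV
  hodgeConjectureQbarAV_of_hodgeConjecture algebraic_of_hodgeConjectureFor hodgeConjectureFor_of_forall_cocycle)

local notation "ℚal" => IntermediateField.toSubfield (algebraicClosure ℚ ℂ)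

/-! ## §A Complexity gauges (DATA; nothing asserted) -/

/-- **A complexity gauge on deform's realization family `𝔇`** (DATA — always an explicit binder
`(κ : ComplexityGauge 𝔇)`, never quantified inside a node): for every prime `O` of `ℚ̄` above `p`, every model
`𝒜` over `O` of an abelian variety `A/ℚ̄`, every `r` and every `ℓ ≠ p`, an `ℕ∞`-valued function on `H^{2r}_ℓ(A₀)`,
`A₀ = 𝒜.specialFibre`, finite EXACTLY on the classes of algebraic cycles with rational coefficients
(`PreWeilCohomology.ratAlgebraicClasses`, Kleiman §1.4). INTENDED VALUE — the only one for which the supply nodes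
`E`, `Z` of §C are claimed in print: `κ(x) = min {|N| + Σᵢ |nᵢ|·deg_θ Zᵢ : N ≠ 0, N•x = Σᵢ nᵢ cl(Zᵢ)}` over
prime cycles `Zᵢ` of codimension `r` on `A₀`, degrees against the reduction of a fixed polarisation `θ` of `A`;
`⊤` off `Aʳ(A₀) ⊗ ℚ`. [cite: Fulton1998, §19.1–19.2] [cite: Kollar1996, Ch. I §3] -/
structure ComplexityGauge (𝔇 : RealizationFamily) where
  /-- the gauge on `H^{2r}_ℓ` of the special fibre of a model `𝒜` over the prime `O` -/
  comp : ∀ {p : ℕ} [Fact p.Prime] {O : ValuationSubring ℚal} [CharP (IsLocalRing.ResidueField O) p]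
    {A : AbelianVariety ℚal} (𝒜 : IntegralModel O ℚal A.X) (r ℓ : ℕ) [Fact ℓ.Prime] (hℓ : ℓ ≠ p),
    ((𝔇 p O).E₀ ℓ hℓ).obj 𝒜.specialFibre (2 * r) → ℕ∞
  /-- the gauge is finite exactly on the rational algebraic classes -/
  comp_lt_top_iff : ∀ {p : ℕ} [Fact p.Prime] {O : ValuationSubring ℚal} [CharP (IsLocalRing.ResidueField O) p]
    {A : AbelianVariety ℚal} (𝒜 : IntegralModel O ℚal A.X) (r ℓ : ℕ) [Fact ℓ.Prime] (hℓ : ℓ ≠ p)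
    (x : ((𝔇 p O).E₀ ℓ hℓ).obj 𝒜.specialFibre (2 * r)),
    comp 𝒜 r ℓ hℓ x < ⊤ ↔ x ∈ ((𝔇 p O).E₀ ℓ hℓ).ratAlgebraicClasses 𝒜.specialFibre r

/-- **The degenerate gauge** (`0` on `Aʳ(A₀) ⊗ ℚ`, `⊤` elsewhere): the binder type is inhabited, and under this `κ`
the supply node `E` reads "rational lifting at infinitely many primes" while `Z` reads "algebraic classes specialise
to rational algebraic classes at almost all primes" — a row's content is the pair (supply nodes for the INTENDED `κ`,
node), as for `𝔇` in deform. [folklore] -/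
def ComplexityGauge.trivial (𝔇 : RealizationFamily) : ComplexityGauge 𝔇 := by
  classical
  exact
    { comp := fun 𝒜 r ℓ _ hℓ x ↦ if x ∈ ((𝔇 _ _).E₀ ℓ hℓ).ratAlgebraicClasses 𝒜.specialFibre r then 0 else ⊤
      comp_lt_top_iff := fun 𝒜 r ℓ _ hℓ x ↦ by
        by_cases hx : x ∈ ((𝔇 _ _).E₀ ℓ hℓ).ratAlgebraicClasses 𝒜.specialFibre r
        · simp only [hx, if_true, ENat.top_pos]
        · simp only [hx, if_false, lt_self_iff_false] }

/-- The binder type `ComplexityGauge 𝔇` is inhabited (by the degenerate gauge). [folklore] -/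
instance (𝔇 : RealizationFamily) : Nonempty (ComplexityGauge 𝔇) := ⟨ComplexityGauge.trivial 𝔇⟩

/-! ## §B Hypothesis shapes (abbreviations and two `Prop`-valued definitions; nothing asserted) -/

variable (𝔇 : RealizationFamily)

/-- "`ζ` is a Hodge cocycle": the complex class of the rational `2r`-cocycle `ζ` on `A_ℂ` has type `(r,r)` — deform's
hypothesis shape, named (an `abbrev`, definitionally the inline form). [folklore] -/
abbrev IsHodgeCocycle (A : AbelianVariety ℚal) (r : ℕ)
    (ζ : singularCochainComplex.cocycles ℚ ℚ (ComplexPoints (A.baseChange ℂ).X) (2 * r)) : Prop :=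
  IsOfHodgeType A.dim (A.baseChange ℂ).X (2 * r) r r
    (singularCohomology.π ℂ ℂ _ (2 * r) (cocycleOfRat _ (2 * r) ζ))

/-- "`ζ_ℂ` is algebraic": the complex class of `ζ` lies in the `ℂ`-span of cycle classes on `A_ℂ`. [folklore] -/
abbrev IsAlgebraicCocycle (A : AbelianVariety ℚal) (r : ℕ)
    (ζ : singularCochainComplex.cocycles ℚ ℚ (ComplexPoints (A.baseChange ℂ).X) (2 * r)) : Prop :=
  singularCohomology.π ℂ ℂ _ (2 * r) (cocycleOfRat _ (2 * r) ζ) ∈ algebraicClasses (A.baseChange ℂ).X r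

/-- **Deform's `J′`-matrix outside the finite set `F`**: at every prime `O` of residue characteristic `p ∉ F`, every
smooth proper model and every `ℓ ≠ p`, the specialisation of `ζ` is the class of a RATIONAL algebraic cycle
(`SpecialisationsRationalAV 𝔇` is `∀ A r ζ, Hodge → ∃ F, RatAlgebraicOutside 𝔇 A r ζ F`, definitionally).
[cite: Milne2009RationalTate, §3.1] -/
abbrev RatAlgebraicOutside (A : AbelianVariety ℚal) (r : ℕ)
    (ζ : singularCochainComplex.cocycles ℚ ℚ (ComplexPoints (A.baseChange ℂ).X) (2 * r)) (F : Finset ℕ) :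
    Prop :=
  ∀ (p : ℕ) [Fact p.Prime], p ∉ F →
    ∀ (O : ValuationSubring ℚal) [CharP (IsLocalRing.ResidueField O) p]
      (𝒜 : IntegralModel O ℚal A.X), 𝒜.IsSmoothProper A.dim →
    ∀ (ℓ : ℕ) [Fact ℓ.Prime] (hℓ : ℓ ≠ p),
      specialisedClass 𝔇 𝒜 r ℓ hℓ ζ ∈ ((𝔇 p O).E₀ ℓ hℓ).ratAlgebraicClasses 𝒜.specialFibre r

/-- **Bounded complexity at infinitely many primes**: there are `d` and a prime `ℓ` such that beyond every finite set
of primes some `p ≠ ℓ` carries a prime `O` of `ℚ̄` and a smooth proper model `𝒜` of `A` over `O` with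
`κ(γ₀) ≤ d`, `γ₀` the `ℓ`-adic specialisation of `ζ` (`Deform.specialisedClass`). [folklore] -/
def BoundedAtInfinitelyManyPrimes (κ : ComplexityGauge 𝔇) (A : AbelianVariety ℚal) (r : ℕ)
    (ζ : singularCochainComplex.cocycles ℚ ℚ (ComplexPoints (A.baseChange ℂ).X) (2 * r)) : Prop :=
  ∃ (d ℓ : ℕ) (_ : Fact ℓ.Prime), ∀ F : Finset ℕ,
    ∃ (p : ℕ) (_ : Fact p.Prime) (hℓ : ℓ ≠ p), p ∉ F ∧
      ∃ (O : ValuationSubring ℚal) (_ : CharP (IsLocalRing.ResidueField O) p) (𝒜 : IntegralModel O ℚal A.X),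
        𝒜.IsSmoothProper A.dim ∧ κ.comp 𝒜 r ℓ hℓ (specialisedClass 𝔇 𝒜 r ℓ hℓ ζ) ≤ d

/-- **Cofinitely bounded complexity** (the conclusion shape of the supply node `Z`): outside a finite set of primes
every `p` carries a prime `O` and a smooth proper model with `κ(γ₀) ≤ d` for EVERY `ℓ ≠ p`. [folklore] -/
def BoundedAtAlmostAllPrimes (κ : ComplexityGauge 𝔇) (A : AbelianVariety ℚal) (r : ℕ)
    (ζ : singularCochainComplex.cocycles ℚ ℚ (ComplexPoints (A.baseChange ℂ).X) (2 * r)) : Prop :=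
  ∃ (d : ℕ) (F : Finset ℕ), ∀ (p : ℕ) [Fact p.Prime], p ∉ F →
    ∃ (O : ValuationSubring ℚal) (_ : CharP (IsLocalRing.ResidueField O) p) (𝒜 : IntegralModel O ℚal A.X),
      𝒜.IsSmoothProper A.dim ∧
        ∀ (ℓ : ℕ) [Fact ℓ.Prime] (hℓ : ℓ ≠ p), κ.comp 𝒜 r ℓ hℓ (specialisedClass 𝔇 𝒜 r ℓ hℓ ζ) ≤ d

/-! ## §C Nodes (`@[conjecture]`: OPEN statements and print-level SUPPLY nodes — hypotheses wherever used) -/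

/-- **`N_E` — NO COMPLEXITY ESCAPE along the primes** (OPEN; the residual of the arithmetic road once its effective
half `E` is split off). For every abelian variety `A/ℚ̄` and every Hodge cocycle whose specialisations are rationally
algebraic at almost all primes (deform's `J′`-matrix), the complexity `κ(γ₀(p))` stays bounded along infinitely
many primes (one `ℓ`). KIND relative to `HC_CM`: 2, robustly (header (a)). On path mod `Z`; weaker than deform's
`R₁` mod `[hgood, Z]`; `⟺ R_aa` mod `[E, Z]`. Nearest print: [BlochEsnaultKerz2014pAdic, Conj. 2]. -/
@[conjecture] def NoComplexityEscape (κ : ComplexityGauge 𝔇) : Prop :=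
  ∀ (A : AbelianVariety ℚal) (r : ℕ)
    (ζ : singularCochainComplex.cocycles ℚ ℚ (ComplexPoints (A.baseChange ℂ).X) (2 * r)),
    IsHodgeCocycle A r ζ → (∃ F : Finset ℕ, RatAlgebraicOutside 𝔇 A r ζ F) →
      BoundedAtInfinitelyManyPrimes 𝔇 κ A r ζ

/-- **`R_aa` — RATIONAL LIFTING AT ALMOST ALL PRIMES** (OPEN; the rational twin of deform's span node `L`): a Hodge
cocycle whose specialisations are rationally algebraic at almost all primes is algebraic. `R₁ ⟹ R_aa` mod `hgood`;
`R_aa ⟺ N_E` mod `[E, Z]`; on path. Nearest print: [BlochEsnaultKerz2014pAdic, Conj. 2]. -/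
@[conjecture] def RationalLiftingAtAlmostAllPrimesAV : Prop :=
  ∀ (A : AbelianVariety ℚal) (r : ℕ)
    (ζ : singularCochainComplex.cocycles ℚ ℚ (ComplexPoints (A.baseChange ℂ).X) (2 * r)),
    IsHodgeCocycle A r ζ → (∃ F : Finset ℕ, RatAlgebraicOutside 𝔇 A r ζ F) → IsAlgebraicCocycle A r ζ

/-- **`B_all` — BOUNDED REDUCTIONS** (OPEN; a REFORMULATION of the endpoint, not a complement: `HC_QbarAV ⟺ B_all`
mod `[E, Z]`): every Hodge cocycle on every `A/ℚ̄` has rationally algebraic specialisations of bounded complexity at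
infinitely many primes. `N_E` is `B_all` relativised to the `J′`-matrix. -/
@[conjecture] def BoundedReductionsAV (κ : ComplexityGauge 𝔇) : Prop :=
  ∀ (A : AbelianVariety ℚal) (r : ℕ)
    (ζ : singularCochainComplex.cocycles ℚ ℚ (ComplexPoints (A.baseChange ℂ).X) (2 * r)),
    IsHodgeCocycle A r ζ → BoundedAtInfinitelyManyPrimes 𝔇 κ A r ζ

/-- **`E` — EFFECTIVE ARITHMETIC SPREADING** (SUPPLY NODE: TRUE IN PRINT, assembled, for the intended `𝔇`, `κ` —
header PROOF SKETCH; a HYPOTHESIS wherever used, never asserted, not vendored; no verbatim locator, header (d)).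
A Hodge cocycle on `A/ℚ̄` with rationally algebraic specialisations of BOUNDED complexity at INFINITELY MANY primes
is algebraic. [cite: Deligne1982HodgeCycles, Thm. 2.11 and Prop. 2.9] [cite: Kollar1996, Ch. I Thm. 1.4, Thm. 3.21, §6]
[cite: DeligneSGA4half1977, Cycle §2.3 and Arcata IV–V] [cite: BLRNeronModels1990, §1.2 Prop. 8]
[cite: StacksProject, Tag 054K] [cite: Milne2009RationalTate, §3.1] -/
@[conjecture] def EffectiveArithmeticSpreading (κ : ComplexityGauge 𝔇) : Prop :=
  ∀ (A : AbelianVariety ℚal) (r : ℕ)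
    (ζ : singularCochainComplex.cocycles ℚ ℚ (ComplexPoints (A.baseChange ℂ).X) (2 * r)),
    IsHodgeCocycle A r ζ → BoundedAtInfinitelyManyPrimes 𝔇 κ A r ζ → IsAlgebraicCocycle A r ζ

/-- **`Z` — ALGEBRAIC CLASSES HAVE COFINITELY BOUNDED REDUCTIONS** (SUPPLY NODE: TRUE IN PRINT for the intended
`𝔇`, `κ`; a hypothesis wherever used, never asserted). If `N•[ζ] = Σ nᵢ cl(Zᵢ)` on `A_ℂ`, the `Zᵢ` may be taken
over `ℚ̄` (specialise a spread of the cycle at a `ℚ̄`-point), then over a number field `k`; their closures in the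
Néron model are flat over an open `U ⊂ Spec 𝒪_k`, fibre degrees are constant in flat families, and specialisation
commutes with cycle classes, so `κ(γ₀(p)) ≤ |N| + Σ |nᵢ| deg Zᵢ` at every `p` under `U`, for every `ℓ ≠ p`.
[cite: Fulton1998, §20.3 and Example 20.3.5] [cite: Andre1996Motifs, §9.4] [cite: BLRNeronModels1990, §1.4 Thm. 3] -/
@[conjecture] def CycleReductionsBounded (κ : ComplexityGauge 𝔇) : Prop :=
  ∀ (A : AbelianVariety ℚal) (r : ℕ)
    (ζ : singularCochainComplex.cocycles ℚ ℚ (ComplexPoints (A.baseChange ℂ).X) (2 * r)),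
    IsAlgebraicCocycle A r ζ → BoundedAtAlmostAllPrimes 𝔇 κ A r ζ

/-! ## §D Kernel rows (pure logic on the binders) -/

variable {𝔇} {κ : ComplexityGauge 𝔇}

/-- A prime beyond a finite set of naturals. [folklore] -/
theorem exists_prime_gt_sup_not_mem (F : Finset ℕ) : ∃ p : ℕ, p.Prime ∧ p ∉ F ∧ F.sup id < p := by
  obtain ⟨p, hle, hp⟩ := Nat.exists_infinite_primes (F.sup id + 1)
  refine ⟨p, hp, fun hmem ↦ ?_, by omega⟩
  have := Finset.le_sup (f := id) hmem
  simp only [id_eq] at this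
  omega

/-- Cofinitely bounded ⟹ bounded at infinitely many primes (infinitude of primes; `ℓ = 2`, `p` odd). [folklore] -/
theorem boundedAtInfinitelyManyPrimes_of_boundedAtAlmostAllPrimes {A : AbelianVariety ℚal} {r : ℕ}
    {ζ : singularCochainComplex.cocycles ℚ ℚ (ComplexPoints (A.baseChange ℂ).X) (2 * r)}
    (h : BoundedAtAlmostAllPrimes 𝔇 κ A r ζ) : BoundedAtInfinitelyManyPrimes 𝔇 κ A r ζ := by
  obtain ⟨d, F, hF⟩ := h
  refine ⟨d, 2, ⟨Nat.prime_two⟩, fun F' ↦ ?_⟩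
  obtain ⟨p, hp, hpF, -⟩ := exists_prime_gt_sup_not_mem (F ∪ F' ∪ {2})
  have h2p : (2 : ℕ) ≠ p := by
    rintro rfl
    exact hpF (by simp)
  haveI : Fact p.Prime := ⟨hp⟩
  obtain ⟨O, hO, 𝒜, h𝒜, hb⟩ := hF p (fun hm ↦ hpF (by simp [hm]))
  exact ⟨p, inferInstance, h2p, fun hm ↦ hpF (by simp [hm]), O, hO, 𝒜, h𝒜, hb 2 h2p⟩

/-- ON PATH: `HC_QbarAV ⟹ R_aa` (the conclusion follows from the Hodge hypothesis alone). [folklore] -/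
theorem rationalLiftingAtAlmostAllPrimesAV_of_hodgeConjectureQbarAV (h : HodgeConjectureQbarAV) :
    RationalLiftingAtAlmostAllPrimesAV 𝔇 := fun A _ ζ hH _ ↦ algebraic_of_hodgeConjectureFor (h A) ζ hH

/-- ON PATH mod `Z`: `HC_QbarAV ⟹ B_all`. [folklore] -/
theorem boundedReductionsAV_of_hodgeConjectureQbarAV (hZ : CycleReductionsBounded 𝔇 κ)
    (h : HodgeConjectureQbarAV) : BoundedReductionsAV 𝔇 κ := fun A r ζ hH ↦
  boundedAtInfinitelyManyPrimes_of_boundedAtAlmostAllPrimes (hZ A r ζ (algebraic_of_hodgeConjectureFor (h A) ζ hH))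

/-- `B_all ⟹ N_E` (forget the `J′` hypothesis). [folklore] -/
theorem noComplexityEscape_of_boundedReductionsAV (h : BoundedReductionsAV 𝔇 κ) : NoComplexityEscape 𝔇 κ :=
  fun A r ζ hH _ ↦ h A r ζ hH

/-- ON PATH mod `Z`: `HC_QbarAV ⟹ N_E`. [folklore] -/
theorem noComplexityEscape_of_hodgeConjectureQbarAV (hZ : CycleReductionsBounded 𝔇 κ)
    (h : HodgeConjectureQbarAV) : NoComplexityEscape 𝔇 κ :=
  noComplexityEscape_of_boundedReductionsAV (boundedReductionsAV_of_hodgeConjectureQbarAV hZ h)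

/-- `B_all ⟹ HC_QbarAV` mod `E`. [folklore] -/
theorem hodgeConjectureQbarAV_of_boundedReductionsAV (hE : EffectiveArithmeticSpreading 𝔇 κ)
    (h : BoundedReductionsAV 𝔇 κ) : HodgeConjectureQbarAV := fun A ↦
  hodgeConjectureFor_of_forall_cocycle A fun r ζ hH ↦ hE A r ζ hH (h A r ζ hH)

/-- **The endpoint REFORMULATED as a growth statement on reductions**, mod `[E, Z]`: `HC_QbarAV ⟺ B_all` — the Hodge
conjecture for abelian varieties over `ℚ̄` says exactly that Hodge classes have rationally algebraic reductions of
bounded complexity at infinitely many primes. Not a complement of `HC_CM` (it needs none). [folklore] -/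
theorem hodgeConjectureQbarAV_iff_boundedReductionsAV (hE : EffectiveArithmeticSpreading 𝔇 κ)
    (hZ : CycleReductionsBounded 𝔇 κ) : HodgeConjectureQbarAV ↔ BoundedReductionsAV 𝔇 κ :=
  ⟨boundedReductionsAV_of_hodgeConjectureQbarAV hZ, hodgeConjectureQbarAV_of_boundedReductionsAV hE⟩

/-- LATTICE mod `hgood` (smooth proper models at almost all primes — deform's classical junction, verbatim; spreading
out and [SerreTate1968, §1]): `R₁ ⟹ R_aa`. [cite: SerreTate1968, §1] -/
theorem rationalLiftingAtAlmostAllPrimesAV_of_rationalLiftingAtOnePrimeAV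
    (hgood : ∀ A : AbelianVariety ℚal, ∃ F : Finset ℕ, ∀ p : ℕ, p.Prime → p ∉ F →
      ∃ (O : ValuationSubring ℚal) (_ : CharP (IsLocalRing.ResidueField O) p)
        (𝒜 : IntegralModel O ℚal A.X), 𝒜.IsSmoothProper A.dim)
    (hR : RationalLiftingAtOnePrimeAV 𝔇) : RationalLiftingAtAlmostAllPrimesAV 𝔇 := by
  rintro A r ζ hH ⟨F, hF⟩
  obtain ⟨F', hF'⟩ := hgood A
  obtain ⟨p, hp, hpF, -⟩ := exists_prime_gt_sup_not_mem (F ∪ F')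
  obtain ⟨O, hO, 𝒜, h𝒜⟩ := hF' p hp (fun hm ↦ hpF (Finset.mem_union_right _ hm))
  haveI : Fact p.Prime := ⟨hp⟩
  exact hR A r ζ hH ⟨p, inferInstance, O, hO, 𝒜, h𝒜, fun ℓ _ hℓ ↦
    hF p (fun hm ↦ hpF (Finset.mem_union_left _ hm)) O 𝒜 h𝒜 ℓ hℓ⟩

/-- `N_E ⟹ R_aa` mod `E`. [folklore] -/
theorem rationalLiftingAtAlmostAllPrimesAV_of_noComplexityEscape (hE : EffectiveArithmeticSpreading 𝔇 κ)
    (hN : NoComplexityEscape 𝔇 κ) : RationalLiftingAtAlmostAllPrimesAV 𝔇 :=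
  fun A r ζ hH hF ↦ hE A r ζ hH (hN A r ζ hH hF)

/-- `R_aa ⟹ N_E` mod `Z`. [folklore] -/
theorem noComplexityEscape_of_rationalLiftingAtAlmostAllPrimesAV (hZ : CycleReductionsBounded 𝔇 κ)
    (hR : RationalLiftingAtAlmostAllPrimesAV 𝔇) : NoComplexityEscape 𝔇 κ := fun A r ζ hH hF ↦
  boundedAtInfinitelyManyPrimes_of_boundedAtAlmostAllPrimes (hZ A r ζ (hR A r ζ hH hF))

/-- **`R_aa ⟺ N_E` mod `[E, Z]`**: the open content of rational lifting is the growth statement. [folklore] -/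
theorem rationalLiftingAtAlmostAllPrimesAV_iff_noComplexityEscape (hE : EffectiveArithmeticSpreading 𝔇 κ)
    (hZ : CycleReductionsBounded 𝔇 κ) : RationalLiftingAtAlmostAllPrimesAV 𝔇 ↔ NoComplexityEscape 𝔇 κ :=
  ⟨noComplexityEscape_of_rationalLiftingAtAlmostAllPrimesAV hZ,
    rationalLiftingAtAlmostAllPrimesAV_of_noComplexityEscape hE⟩

/-- `R₁ ⟹ N_E` mod `[hgood, Z]`: `N_E` is weaker than deform's rational single-prime node. [folklore] -/
theorem noComplexityEscape_of_rationalLiftingAtOnePrimeAV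
    (hgood : ∀ A : AbelianVariety ℚal, ∃ F : Finset ℕ, ∀ p : ℕ, p.Prime → p ∉ F →
      ∃ (O : ValuationSubring ℚal) (_ : CharP (IsLocalRing.ResidueField O) p)
        (𝒜 : IntegralModel O ℚal A.X), 𝒜.IsSmoothProper A.dim)
    (hZ : CycleReductionsBounded 𝔇 κ) (hR : RationalLiftingAtOnePrimeAV 𝔇) : NoComplexityEscape 𝔇 κ :=
  noComplexityEscape_of_rationalLiftingAtAlmostAllPrimesAV hZ
    (rationalLiftingAtAlmostAllPrimesAV_of_rationalLiftingAtOnePrimeAV hgood hR)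

/-- **ROW IX-A.** `HC_CM`, deform's special-lift junction `hJ' : HC_CM → J′` (CM lifting of the pair `(A₀, γ₀)`
[Milne2009RationalTate, Aside 4.6] with [Kisin2017]; an explicit hypothesis, NOT a fact), the supply node `E` and the
growth statement `N_E` give `HC_QbarAV`; `HC_CM` is load-bearing through `hJ'`. [cite: Milne2009RationalTate, Aside 4.6] -/
theorem HC_QbarAV_of_HC_CM_and_noComplexityEscape (hJ' : CMAbelianHodge → SpecialisationsRationalAV 𝔇)
    (hE : EffectiveArithmeticSpreading 𝔇 κ) (hCM : CMAbelianHodge) (hN : NoComplexityEscape 𝔇 κ) :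
    HodgeConjectureQbarAV := fun A ↦
  hodgeConjectureFor_of_forall_cocycle A fun r ζ hH ↦ hE A r ζ hH (hN A r ζ hH (hJ' hCM A r ζ hH))

/-- **ROW IX-A via `R_aa`** (deform's row A′ factors as `R₁ ⟹[hgood] R_aa` followed by this). [folklore] -/
theorem HC_QbarAV_of_HC_CM_and_rationalLiftingAtAlmostAllPrimesAV
    (hJ' : CMAbelianHodge → SpecialisationsRationalAV 𝔇) (hCM : CMAbelianHodge)
    (hR : RationalLiftingAtAlmostAllPrimesAV 𝔇) : HodgeConjectureQbarAV := fun A ↦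
  hodgeConjectureFor_of_forall_cocycle A fun r ζ hH ↦ hR A r ζ hH (hJ' hCM A r ζ hH)

/-- **ROW IX-A, exactness** mod `[hJ', E, Z, hQC]` (`hQC : HC_QbarAV → HC_CM`: CM abelian varieties descend to `ℚ̄`,
discharged from the isogeny-descent binder by deform's `HC_CM_of_hodgeConjectureQbarAV_of_cmQbarDescent`):
**`HC_QbarAV ⟺ HC_CM ∧ N_E`**. [cite: Shimura1998, §12.4 Prop. 26] -/
theorem HC_QbarAV_iff_HC_CM_and_noComplexityEscape (hJ' : CMAbelianHodge → SpecialisationsRationalAV 𝔇)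
    (hE : EffectiveArithmeticSpreading 𝔇 κ) (hZ : CycleReductionsBounded 𝔇 κ)
    (hQC : HodgeConjectureQbarAV → CMAbelianHodge) :
    HodgeConjectureQbarAV ↔ CMAbelianHodge ∧ NoComplexityEscape 𝔇 κ :=
  ⟨fun h ↦ ⟨hQC h, noComplexityEscape_of_hodgeConjectureQbarAV hZ h⟩,
    fun h ↦ HC_QbarAV_of_HC_CM_and_noComplexityEscape hJ' hE h.1 h.2⟩

/-- **ROW IX-B (to `HC_AV`, with part VIII's fact-free complement `F_ℚ̄` of the endpoint).** [folklore] -/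
theorem HC_AV_of_HC_CM_and_noComplexityEscape_of_hodgeFailureSpreadsToQbarFibre
    (hJ' : CMAbelianHodge → SpecialisationsRationalAV 𝔇) (hE : EffectiveArithmeticSpreading 𝔇 κ)
    (hCM : CMAbelianHodge) (hN : NoComplexityEscape 𝔇 κ) (hF : HodgeFailureSpreadsToQbarFibre) :
    HodgeAbelianVarieties :=
  HC_AV_of_HC_QbarAV_of_hodgeFailureSpreadsToQbarFibre (HC_QbarAV_of_HC_CM_and_noComplexityEscape hJ' hE hCM hN) hF

/-- **ROW IX-B, exactness** mod `[hJ', E, Z, hQC]`: **`HC_AV ⟺ HC_CM ∧ N_E ∧ F_ℚ̄`** — granted `HC_CM`, Hodge for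
all abelian varieties is "no complexity escape along the primes" plus "Hodge failures spread to `ℚ̄`-fibres". [folklore] -/
theorem HC_AV_iff_HC_CM_and_noComplexityEscape_and_hodgeFailureSpreadsToQbarFibre
    (hJ' : CMAbelianHodge → SpecialisationsRationalAV 𝔇) (hE : EffectiveArithmeticSpreading 𝔇 κ)
    (hZ : CycleReductionsBounded 𝔇 κ) (hQC : HodgeConjectureQbarAV → CMAbelianHodge) :
    HodgeAbelianVarieties ↔ CMAbelianHodge ∧ NoComplexityEscape 𝔇 κ ∧ HodgeFailureSpreadsToQbarFibre := by
  rw [HC_AV_iff_HC_QbarAV_and_hodgeFailureSpreadsToQbarFibre,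
    HC_QbarAV_iff_HC_CM_and_noComplexityEscape hJ' hE hZ hQC, and_assoc]

/-- ON-PATH audit from the summit mod `Z`: `HodgeConjecture ⟹ N_E ∧ R_aa ∧ B_all`. [folklore] -/
theorem arithmeticSpread_nodes_of_hodgeConjecture (hZ : CycleReductionsBounded 𝔇 κ)
    (hHC : _root_.HodgeConjecture) :
    NoComplexityEscape 𝔇 κ ∧ RationalLiftingAtAlmostAllPrimesAV 𝔇 ∧ BoundedReductionsAV 𝔇 κ :=
  ⟨noComplexityEscape_of_hodgeConjectureQbarAV hZ (hodgeConjectureQbarAV_of_hodgeConjecture hHC),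
    rationalLiftingAtAlmostAllPrimesAV_of_hodgeConjectureQbarAV (hodgeConjectureQbarAV_of_hodgeConjecture hHC),
    boundedReductionsAV_of_hodgeConjectureQbarAV hZ (hodgeConjectureQbarAV_of_hodgeConjecture hHC)⟩

end Summit.HodgeConjecture.HodgeConjecture.Ring2.AbelianAll
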